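import Mathlib
import Literature.MathematicalPhysics.QuantumLattice.FermionLiebRobinson
import Literature.MathematicalPhysics.QuantumLattice.HubbardTorusChargeFluctuations

/-!
# `stub_hamiltonianNormBound` (S1a of line `lro-seed-kink-bridge`, crux stmt-HubbardSuperconductivity-2010) — proof

Refuter evidence (positive; for the lead prover to land / inline): the grand-canonical torus Hubbard
Hamiltonian has operator norm linear in the volume,
`‖H(1,U) - μN‖ ≤ 10 (1 + U + |μ|) L²` for `U ≥ 0`, by the local-term decomposition
`sum_hubbardTermOp` (`‖h_Z‖ ≤ 2|t| + |U| + 2|μ|`, `norm_hubbardTermOp_le`) and the term count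
`card_hubbardIdx_torus_le : #terms ≤ (2d+1) L^d = 5 L²`.
-/

namespace Summit.HubbardSuperconductivity.HubbardSuperconductivity.Cruxes.WcbcsBcsConstruction.LroSeedKinkBridgeS1a

open Literature.MathematicalPhysics.QuantumLattice Matrix
open scoped Matrix.Norms.L2Operator

/-- S1a, verbatim the lead's stub signature: `‖hubbardTorusWith 2 L 1 U μ‖ ≤ B₁ (1 + U + |μ|) L²`
with `B₁ = 10`. [folklore] -/
theorem hamiltonianNormBound :
    ∃ B₁ : ℝ, 0 < B₁ ∧ ∀ (L : ℕ) [NeZero L] (U μ : ℝ), 0 ≤ U →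
      ‖hubbardTorusWith 2 L 1 U μ‖ ≤ B₁ * (1 + U + |μ|) * (L : ℝ) ^ 2 := by
  refine ⟨10, by norm_num, fun L _ U μ hU => ?_⟩
  have hH : hubbardTorusWith 2 L 1 U μ =
      ∑ Z, hubbardTermOp (fermionTorusGraph 2 L) 1 U μ Z :=
    (sum_hubbardTermOp (fermionTorusGraph 2 L) 1 U μ).symm
  have hcard : (Fintype.card (HubbardIdx (fermionTorusGraph 2 L)) : ℝ) ≤ 5 * (L : ℝ) ^ 2 := by
    have h := card_hubbardIdx_torus_le 2 L
    have h' : ((Fintype.card (HubbardIdx (fermionTorusGraph 2 L)) : ℕ) : ℝ) ≤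
        (((2 * 2 + 1) * L ^ 2 : ℕ) : ℝ) := by exact_mod_cast h
    simpa using h'
  have hterm : ∀ Z, ‖hubbardTermOp (fermionTorusGraph 2 L) 1 U μ Z‖ ≤ 2 + U + 2 * |μ| := fun Z =>
    calc ‖hubbardTermOp (fermionTorusGraph 2 L) 1 U μ Z‖ ≤ 2 * |(1 : ℝ)| + |U| + 2 * |μ| :=
          norm_hubbardTermOp_le (fermionTorusGraph 2 L) 1 U μ Z
      _ = 2 + U + 2 * |μ| := by rw [abs_one, abs_of_nonneg hU]; ring
  calc ‖hubbardTorusWith 2 L 1 U μ‖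
      = ‖∑ Z, hubbardTermOp (fermionTorusGraph 2 L) 1 U μ Z‖ := by rw [hH]
    _ ≤ ∑ Z, ‖hubbardTermOp (fermionTorusGraph 2 L) 1 U μ Z‖ := norm_sum_le _ _
    _ ≤ ∑ _Z : HubbardIdx (fermionTorusGraph 2 L), (2 + U + 2 * |μ|) :=
        Finset.sum_le_sum fun Z _ => hterm Z
    _ = (Fintype.card (HubbardIdx (fermionTorusGraph 2 L)) : ℝ) * (2 + U + 2 * |μ|) := by
        rw [Finset.sum_const, Finset.card_univ, nsmul_eq_mul]
    _ ≤ 5 * (L : ℝ) ^ 2 * (2 + U + 2 * |μ|) := by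
        have hK : 0 ≤ 2 + U + 2 * |μ| := by positivity
        exact mul_le_mul_of_nonneg_right hcard hK
    _ ≤ 10 * (1 + U + |μ|) * (L : ℝ) ^ 2 := by
        have hL : 0 ≤ (L : ℝ) ^ 2 := by positivity
        have hμ : 0 ≤ |μ| := abs_nonneg μ
        nlinarith

end Summit.HubbardSuperconductivity.HubbardSuperconductivity.Cruxes.WcbcsBcsConstruction.LroSeedKinkBridgeS1a
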